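import Mathlib
import Summits.NavierStokesRegularity.NavierStokesRegularity.Theorems.EulerZoomLiouvillePowerGaugeEulerLiouvilleSelfSimilarTopBadNodeExitThreshold
import Summits.NavierStokesRegularity.NavierStokesRegularity.Theorems.EulerZoomLiouvillePowerGaugeEulerLiouvilleSelfSimilarTopBadNodeExitBump
import Summits.NavierStokesRegularity.NavierStokesRegularity.Theorems.EulerZoomLiouvillePowerGaugeEulerLiouvilleSelfSimilarLimitSetKill
import HarnessLib.Audit

/-!
# Rung C1 of the crux `EulerZoomLiouville.PowerGaugeEulerLiouville`: the NO-EXIT LEMMA (structural form)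
# (blueprint §3 — everything except the arithmetic choice of the constants)

Route №10 `EulerZoomLiouville` (NavierStokesRegularity), crux E = stmt-NavierStokesRegularity-19832,
tenure rung C1 (exactly self-similar members), registered residue `stub_selfSimilarExtremal`.
Thirtieth file of the NODAL-CONTINUUM line (lineage ns-typeII-p1, gen 7).  At a degenerate non-vortical node `z` of a
`C²` profile (`0 < γ < ½`, far field (3.8)) with kernel graph `(g, φ)` (`exists_kernelGraph_data`), spectral data of
`A = DV(z)`, accuracies `ρ, η, ν, Cν` valid on `B̄(z, δ)`, radii `ε ≤ r/8`, `4r ≤ δ`, and ALL the smallness conditions of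
the three exit cases (`…ExitThreshold`, `…ExitArcSide`, `…ExitBump`) plus the side data (each side `±[r/4, r/2]` is an
ARC of nodes or carries a point `σ±` with `φ(σ±) ≠ 0` whose `ε`-conditions hold) and the cap conditions:

* `noExit_of_conditions` — every vortical `x ∈ B(z, ε)` with `ℋ < ℋ(z)` on the vortical set is backward-trapped in
  `B̄(z, r)`.  Proof: first exit `t₁`; the exiting trajectory is never stagnant (fixed points of the flow); tube
  coordinates and `tube_inequalities`; `M₁ = max |φ∘σ|` (compactness); threshold ⇒ `false_of_exit_threshold`; no
  threshold ⇒ `|ξ(t₁)| ≤ r/8` ⇒ cap `|σ(t₁)| ≥ r/2` on a side `s = ±1`; after the reflection `e ↦ se`, `g ↦ g(s·)`,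
  `φ ↦ sφ(s·)`, `σ ↦ sσ`: arc side ⇒ `false_of_exit_arcSide`; bump side ⇒ the point `σ_s` is crossed, `M₁ ≥ |φ(sσ_s)|`,
  `false_of_exit_bump`.

WHAT THIS IS NOT: not NS, not E; the caller (`false_of_topBadNode_of_graph`, to come) chooses the constants and combines
with the cone lemma `exists_thinRadius_of_badNode`. [cite: ConstantinIgnatovaVicol2026Putative, §3.4.3–§3.5, §4]
[cite: KatokHasselblatt1995, §6.2]
-/

noncomputable section

-- flat `Theorems/<Route><Decl>…` files of one crux share the namespace of the crux (tree convention)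
set_option linter.dupNamespace false

open Set Filter Topology Metric Function InnerProductSpace
open scoped RealInnerProductSpace NNReal

namespace Summit.NavierStokesRegularity.NavierStokesRegularity.Theorems.PowerGaugeEulerLiouville.NodalContinuum

open Literature.Analysis Literature.Analysis.FluidPDE Literature.Analysis.ODE
open Summit.NavierStokesRegularity.NavierStokesRegularity.Theorems.PowerGaugeEulerLiouville.NodalFiniteness

variable {γ C : ℝ} {c : EuclideanSpace ℝ (Fin 3)}
  {U : EuclideanSpace ℝ (Fin 3) → EuclideanSpace ℝ (Fin 3)} {P : EuclideanSpace ℝ (Fin 3) → ℝ}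

set_option maxHeartbeats 1600000 in
/-- **The no-exit lemma, structural form.**  See the module docstring.
[cite: ConstantinIgnatovaVicol2026Putative, §3.4.3–§3.5, §4 (local analysis not in print)] [cite: KatokHasselblatt1995, §6.2 (cone criterion)] -/
theorem noExit_of_conditions (h : IsSelfSimilarEulerProfile γ c U P) (hγ : 0 < γ) (hγ2 : γ < 1 / 2)
    (hfar : HasSelfSimilarFarFieldWith γ c C U)
    {z : EuclideanSpace ℝ (Fin 3)} (hΩz : curl U z = 0)
    (hconf : ∀ x, curl U x ≠ 0 → selfSimilarBernoulli γ c U P x < selfSimilarBernoulli γ c U P z)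
    {e : EuclideanSpace ℝ (Fin 3)} (he1 : ‖e‖ = 1) (hAe : fderiv ℝ (selfSimilarTransport γ c U) z e = 0)
    {b : OrthonormalBasis (Fin 3) ℝ (EuclideanSpace ℝ (Fin 3))} {a : Fin 3 → ℝ} {μ α K : ℝ}
    (hb : ∀ i, fderiv ℝ (selfSimilarTransport γ c U) z (b i) = a i • b i) (hμ : 0 < μ) (hμα : μ ≤ α)
    (hαge : ∀ i, a i ≤ α) (hpos_i : ∀ i, 0 < a i → μ ≤ a i)
    (hneg_i : ∀ ξ : EuclideanSpace ℝ (Fin 3), ⟪e, ξ⟫ = 0 → ∀ i, ¬ 0 < a i → a i ≤ -μ ∨ ⟪b i, ξ⟫ = 0)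
    (hK : K = 2 * α / μ + 1)
    {g g' : ℝ → EuclideanSpace ℝ (Fin 3)} {φ : ℝ → ℝ} {δ L C₁ : ℝ} (hL : 0 ≤ L) (hC₁pos : 0 < C₁)
    (hg0 : g 0 = 0) (hge : ∀ τ, ⟪e, g τ⟫ = 0) (hgd : ∀ τ, HasDerivAt g (g' τ) τ)
    (hg' : ∀ τ, |τ| ≤ δ → ‖g' τ‖ ≤ L * |τ|)
    (hpar : ∀ τ, |τ| ≤ δ → selfSimilarTransport γ c U (z + τ • e + g τ) = φ τ • e)
    (hφc : Continuous φ) (hφsq : ∀ τ, |τ| ≤ δ → |φ τ| ≤ C₁ * τ ^ 2)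
    (hφlip : ∀ τ τ', |τ| ≤ δ → |τ'| ≤ δ → |φ τ - φ τ'| ≤ C₁ * δ * |τ - τ'|)
    {ρ η ν Cν : ℝ} (hρ : 0 < ρ) (hη : 0 < η) (hν : 0 < ν) (hCν : 0 ≤ Cν)
    (hlin : ∀ x ∈ closedBall z δ, ∀ y ∈ closedBall z δ,
      ‖(selfSimilarTransport γ c U x - selfSimilarTransport γ c U y) -
        fderiv ℝ (selfSimilarTransport γ c U) z (x - y)‖ ≤ ρ * ‖x - y‖)
    (hηU : ∀ y ∈ closedBall z δ, 2 * ‖fderiv ℝ U y - fderiv ℝ U z‖ ≤ η)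
    (hexp : ∀ y : EuclideanSpace ℝ (Fin 3), ‖y - z‖ ≤ δ → ∀ ζ : EuclideanSpace ℝ (Fin 3), ‖ζ‖ ≤ δ →
      selfSimilarBernoulli γ c U P y + fderiv ℝ (selfSimilarBernoulli γ c U P) y ζ +
          (1 / 2 * ((2 * γ - 1) * ⟪fderiv ℝ (selfSimilarTransport γ c U) z ζ, ζ⟫) -
            (ν + Cν * ‖selfSimilarTransport γ c U y‖) * ‖ζ‖ ^ 2) ≤
        selfSimilarBernoulli γ c U P (y + ζ))
    {r ε C₃ κ : ℝ} (hr : 0 < r) (hrδ : 4 * r ≤ δ) (hε : 0 < ε) (hεr : ε ≤ r / 8) (hC₃ : 0 ≤ C₃)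
    (hnode : ∀ x, ‖x - z‖ ≤ ε → selfSimilarBernoulli γ c U P z - C₃ * ε ^ 2 ≤ selfSimilarBernoulli γ c U P x)
    (hκ : κ = 512 * η ^ 2 / ((1 - 2 * γ) ^ 2 * μ ^ 2) + 16 * (1 + K) * (L * r) ^ 2 / μ ^ 2)
    -- smallness (accuracies, radii, ε)
    (hρ1 : 18 * ρ ^ 2 / μ * (1 + K) ≤ μ / 16) (hρ2 : ρ ≤ μ / 2) (hν1 : ν ≤ (1 - 2 * γ) * μ / 64)
    (hrCν : Cν * C₁ * r ^ 2 ≤ (1 - 2 * γ) * μ / 64) (hrθ : η * (1 + 2 * L * r) ≤ (1 - 2 * γ) / 2) (hLr : L * r ≤ 1 / 4)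
    (hεT : 3 * (1 - 2 * γ) * C₁ * ε / 2 + 3 * ρ ^ 2 * C₃ / μ ^ 2 ≤ (1 - 2 * γ) * μ / 32 * (18 * (1 + K)))
    (hrArc : 6 * ρ * (1 + K) * Real.sqrt (2 * κ) * C₁ * r ≤ μ / 16)
    (hεArc : 6 * ρ * (1 + K) * Real.sqrt 2 * 3 * Real.sqrt (1 + K) * ε ≤ μ * r / 16)
    (hρ3 : ρ * Real.sqrt (2 * (1 + K)) * Real.sqrt κ ≤ 1 / 16)
    (hrBump : ((1 - 2 * γ) * α / 2 + ν + Cν * C₁ * r ^ 2) * (2 * (1 + K)) * κ +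
        η * Real.sqrt (2 * (1 + K)) * Real.sqrt κ ≤ (1 - 2 * γ) / (160 * C₁ * δ))
    (hcapr : 2 * (1 + K) * κ * (C₁ * r ^ 2) ^ 2 ≤ r ^ 2 / 128)
    (hcapε : 2 * (1 + K) * (9 * (1 + K) * ε ^ 2) ≤ r ^ 2 / 128)
    -- side data: each side is an arc of nodes on `[r/4, r/2]` or carries a forcing point whose `ε`-conditions hold
    (hside : ∀ s : ℝ, s * s = 1 →
      (∀ τ ∈ Icc (r / 4) (r / 2), φ (s * τ) = 0) ∨
      (∃ σ₀ ∈ Icc (r / 4) (r / 2), φ (s * σ₀) ≠ 0 ∧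
        ε < Real.sqrt (|φ (s * σ₀)| / C₁) / 2 ∧
        ρ * (Real.sqrt (2 * (1 + K)) * (3 * Real.sqrt (1 + K)) * ε) ≤ |φ (s * σ₀)| / 16 ∧
        η * Real.sqrt (2 * (1 + K)) * (3 * Real.sqrt (1 + K)) * ε ≤ (1 - 2 * γ) * |φ (s * σ₀)| / (160 * C₁ * δ) ∧
        ((1 - 2 * γ) * α / 2 + ν + Cν * C₁ * r ^ 2) * (2 * (1 + K)) * (9 * (1 + K) * ε ^ 2) +
          3 * (1 - 2 * γ) * C₁ * ε ^ 3 / 2 + 3 * ρ ^ 2 * C₃ * ε ^ 2 / μ ^ 2 ≤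
          (1 - 2 * γ) * |φ (s * σ₀)| ^ 2 / (160 * C₁ * δ))) :
    ∀ x, curl U x ≠ 0 → dist x z < ε →
      ∀ t, 0 ≤ t → lipschitzFlow (lipschitzWith_transport h hγ hfar) x (-t) ∈ closedBall z r := by
  classical
  set V := selfSimilarTransport γ c U with hV
  set A : EuclideanSpace ℝ (Fin 3) →L[ℝ] EuclideanSpace ℝ (Fin 3) := fderiv ℝ V z with hAdef
  set Hb := selfSimilarBernoulli γ c U P with hHb
  have hKlip := lipschitzWith_transport h hγ hfar
  have hA : (A : EuclideanSpace ℝ (Fin 3) →ₗ[ℝ] EuclideanSpace ℝ (Fin 3)).IsSymmetric :=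
    isSymmetric_fderiv_transport_of_curl_eq_zero h hΩz
  have hAe' : A e = 0 := hAe
  have hee : ⟪e, e⟫ = 1 := by rw [real_inner_self_eq_norm_sq, he1]; norm_num
  have hKge1 : 1 ≤ K := by
    have : 0 ≤ 2 * α / μ := div_nonneg (by linarith) hμ.le
    rw [hK]; linarith
  have hκ0 : 0 ≤ κ := by rw [hκ]; positivity
  intro x hxO hxε
  by_contra hnot
  push Not at hnot
  obtain ⟨t₀, ht₀, hout⟩ := hnot
  rw [mem_closedBall, dist_eq_norm, not_le] at hout
  set Y : ℝ → EuclideanSpace ℝ (Fin 3) := fun t => lipschitzFlow hKlip x (-t) with hYdef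
  have hY : ∀ t, HasDerivAt Y ((-1 : ℝ) • V (Y t)) t := hasDerivAt_backwardFlow hKlip x
  have hY0 : Y 0 = x := by simp [hYdef]
  have hYc : Continuous Y := continuous_iff_continuousAt.2 fun t => (hY t).continuousAt
  obtain ⟨Bd, hBd⟩ := backward_orbit_bounded hγ hfar hY
  have hxε' : ‖Y 0 - z‖ < ε := by rw [hY0, ← dist_eq_norm]; exact hxε
  have h0r : ‖Y 0 - z‖ < r := by linarith
  obtain ⟨t₁, ht₁, -, hexit, hin, -⟩ := exists_firstExit hYc h0r ht₀ hout
  have ht₁m : t₁ ∈ Icc 0 t₁ := ⟨ht₁.le, le_rfl⟩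
  have hYO : ∀ t, 0 ≤ t → curl U (Y t) ≠ 0 := by
    intro t ht h0
    have := curl_comp_eq_zero_of_curl_comp_eq_zero h hY hBd ht h0
    rw [hY0] at this
    exact hxO this
  have hHlt : Hb (Y t₁) < Hb z := hconf _ (hYO t₁ ht₁.le)
  have hH0 : Hb z - C₃ * ε ^ 2 ≤ Hb (Y 0) := hnode _ hxε'.le
  -- the trajectory is never stagnant
  have hstag : ∀ t ∈ Icc 0 t₁, V (Y t) ≠ 0 := by
    intro t ht hVt
    have hfix : ∀ s, lipschitzFlow hKlip (Y t) s = Y t := lipschitzFlow_eq_self_of_eq_zero hKlip hVt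
    have hx : x = Y t := by
      have := lipschitzFlow_neg_lipschitzFlow hKlip x (-t)
      rw [neg_neg] at this
      calc x = lipschitzFlow hKlip (lipschitzFlow hKlip x (-t)) t := this.symm
        _ = lipschitzFlow hKlip (Y t) t := rfl
        _ = Y t := hfix t
    have h1 : Y t₁ = Y t := by
      show lipschitzFlow hKlip x (-t₁) = Y t
      rw [hx]; exact hfix _
    have : ‖Y t₁ - z‖ < ε := by rw [h1, ← hx, ← hY0]; exact hxε'
    linarith
  /- tube coordinates -/
  set σ : ℝ → ℝ := fun t => ⟪e, Y t - z⟫ with hσdef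
  set ξ : ℝ → EuclideanSpace ℝ (Fin 3) := fun t => Y t - z - σ t • e - g (σ t) with hξdef
  have hσ : ∀ t, σ t = ⟪e, Y t - z⟫ := fun t => rfl
  have hξ : ∀ t, ξ t = Y t - z - σ t • e - g (σ t) := fun t => rfl
  have hσle : ∀ t ∈ Icc 0 t₁, |σ t| ≤ r := fun t ht =>
    ((abs_real_inner_le_norm e _).trans (by rw [he1, one_mul])).trans (hin t ht)
  have hgeo := fun τ (hτ : |τ| ≤ r) => norm_graph_le_quarter he1 hL hr hrδ hLr hg0 hgd hg' hτ
  have hYΓξ : ∀ t, Y t = (z + σ t • e + g (σ t)) + ξ t := by intro t; rw [hξ t]; abel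
  have hE : ∀ t ∈ Icc 0 t₁, ‖V (Y t) - φ (σ t) • e - A (ξ t)‖ ≤ ρ * ‖ξ t‖ := by
    intro t ht
    have hm1 : Y t ∈ closedBall z δ := by
      rw [mem_closedBall, dist_eq_norm]; linarith [hin t ht]
    have hm2 : z + σ t • e + g (σ t) ∈ closedBall z δ := by
      rw [mem_closedBall, dist_eq_norm, show z + σ t • e + g (σ t) - z = σ t • e + g (σ t) by abel]
      linarith [(hgeo (σ t) (hσle t ht)).2]
    have h1 := hlin (Y t) hm1 _ hm2
    have hVΓ : V (z + σ t • e + g (σ t)) = φ (σ t) • e := hpar (σ t) ((hσle t ht).trans (by linarith))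
    have e1 : Y t - (z + σ t • e + g (σ t)) = ξ t := by rw [hξ t]; abel
    rw [hVΓ, e1] at h1
    exact h1
  have hg'b : ∀ t ∈ Icc 0 t₁, ‖g' (σ t)‖ ≤ L * r := fun t ht =>
    (hg' (σ t) ((hσle t ht).trans (by linarith))).trans (mul_le_mul_of_nonneg_left (hσle t ht) hL)
  obtain ⟨p, m, pd, md, hpm, hpnn, hmnn, hp', hm', hpd, hmd, hAξ, hσ'⟩ :=
    tube_inequalities hA b hb hμ hαge hpos_i he1 hAe' hneg_i hY hge hgd hσ hξ hρ.le
      (by positivity : (0:ℝ) ≤ L * r) (by linarith : L * r ≤ 1) hE hg'b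
  /- the trajectory maximum `M₁` -/
  have hσc : Continuous σ := continuous_const.inner (hYc.sub continuous_const)
  obtain ⟨tstar, htstar, hmax'⟩ := (isCompact_Icc : IsCompact (Icc (0:ℝ) t₁)).exists_isMaxOn
    (nonempty_Icc.2 ht₁.le) ((hφc.comp hσc).abs.continuousOn)
  set M₁ : ℝ := |φ (σ tstar)| with hM₁def
  have hM₁ : ∀ t ∈ Icc 0 t₁, |φ (σ t)| ≤ M₁ := fun t ht => hmax' ht
  have hM₁0 : 0 ≤ M₁ := abs_nonneg _
  have hM₁r : M₁ ≤ C₁ * r ^ 2 := by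
    have h1 := hφsq (σ tstar) ((hσle tstar htstar).trans (by linarith))
    have h2 : σ tstar ^ 2 ≤ r ^ 2 := by
      rw [← sq_abs]; exact pow_le_pow_left₀ (abs_nonneg _) (hσle tstar htstar) 2
    exact h1.trans (mul_le_mul_of_nonneg_left h2 hC₁pos.le)
  set Θ : ℝ := κ * M₁ ^ 2 + 9 * (1 + K) * ε ^ 2 with hΘ
  /- dispatch: threshold -/
  by_cases hthr : ∃ t ∈ Icc 0 t₁, 2 * (1 + K) * Θ ≤ p t + m t
  · obtain ⟨t, ht, hbig⟩ := hthr
    exact false_of_exit_threshold h hγ hγ2 hΩz he1 hAe hb hμ hμα hpos_i hneg_i hK hL hC₁pos.le hg0 hge hgd hg'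
      hpar hφc hφsq hρ hη hCν hηU hexp hr hrδ hε hεr hY ht₁ hin hxε' hHlt hH0 hσ hξ hpm hpnn hmnn hp' hm'
      hpd hmd hAξ hE hM₁ hM₁0 hκ hΘ hρ1 hρ2 hν1 hrCν hrθ hLr hεT ht hbig
  push Not at hthr
  have hsmall : ∀ t ∈ Icc 0 t₁, p t + m t < 2 * (1 + K) * Θ := hthr
  /- no threshold: the exit is a cap -/
  have hΘr : 2 * (1 + K) * Θ ≤ (r / 8) ^ 2 := by
    have h1 : κ * M₁ ^ 2 ≤ κ * (C₁ * r ^ 2) ^ 2 :=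
      mul_le_mul_of_nonneg_left (pow_le_pow_left₀ hM₁0 hM₁r 2) hκ0
    have h2 : 2 * (1 + K) * Θ = 2 * (1 + K) * (κ * M₁ ^ 2) + 2 * (1 + K) * (9 * (1 + K) * ε ^ 2) := by
      rw [hΘ]; ring
    have h3 : 2 * (1 + K) * (κ * M₁ ^ 2) ≤ 2 * (1 + K) * (κ * (C₁ * r ^ 2) ^ 2) :=
      mul_le_mul_of_nonneg_left h1 (by linarith)
    nlinarith [hcapr, hcapε, h2, h3]
  have hξ₁ : ‖ξ t₁‖ ≤ r / 8 := by
    have h1 : ‖ξ t₁‖ ^ 2 ≤ (r / 8) ^ 2 := by rw [← hpm t₁]; exact (hsmall t₁ ht₁m).le.trans hΘr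
    exact (pow_le_pow_iff_left₀ (norm_nonneg _) (by positivity) two_ne_zero).1 h1
  have hcap : r / 2 ≤ |σ t₁| := by
    have h1 : ‖Y t₁ - z‖ ≤ ‖σ t₁ • e‖ + ‖g (σ t₁)‖ + ‖ξ t₁‖ := by
      rw [hYΓξ t₁, show z + σ t₁ • e + g (σ t₁) + ξ t₁ - z = σ t₁ • e + g (σ t₁) + ξ t₁ by abel]
      exact (norm_add_le _ _).trans (add_le_add (norm_add_le _ _) le_rfl)
    rw [norm_smul, Real.norm_eq_abs, he1, mul_one, hexit] at h1
    linarith [(hgeo (σ t₁) (hσle t₁ ht₁m)).1]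
  /- the exit side `s` and the reflected data -/
  obtain ⟨s, hs1, hsσ⟩ : ∃ s : ℝ, s * s = 1 ∧ r / 2 ≤ s * σ t₁ := by
    rcases le_or_gt 0 (σ t₁) with h0 | h0
    · exact ⟨1, by norm_num, by rw [one_mul]; rwa [abs_of_nonneg h0] at hcap⟩
    · exact ⟨-1, by norm_num, by rw [abs_of_neg h0] at hcap; linarith⟩
  have hsabs : |s| = 1 := by
    have : |s| * |s| = 1 := by rw [← abs_mul, hs1, abs_one]
    rcases mul_self_eq_one_iff.1 this with h1 | h1
    · exact h1
    · linarith [abs_nonneg s]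
  -- reflected objects
  set e' : EuclideanSpace ℝ (Fin 3) := s • e with he'
  set gs : ℝ → EuclideanSpace ℝ (Fin 3) := fun τ => g (s * τ) with hgs
  set φs : ℝ → ℝ := fun τ => s * φ (s * τ) with hφs
  set σs : ℝ → ℝ := fun t => s * σ t with hσs
  have he'1 : ‖e'‖ = 1 := by rw [he', norm_smul, Real.norm_eq_abs, hsabs, one_mul, he1]
  have hAe's : A e' = 0 := by rw [he', map_smul, hAe', smul_zero]
  have hneg_i' : ∀ ξ : EuclideanSpace ℝ (Fin 3), ⟪e', ξ⟫ = 0 → ∀ i, ¬ 0 < a i → a i ≤ -μ ∨ ⟪b i, ξ⟫ = 0 := by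
    intro ζ hζ
    apply hneg_i ζ
    rw [he', real_inner_smul_left] at hζ
    rcases mul_eq_zero.1 hζ with h1 | h1
    · exfalso; rw [h1] at hs1; norm_num at hs1
    · exact h1
  have hpars : ∀ τ, |τ| ≤ δ → V (z + τ • e' + gs τ) = φs τ • e' := by
    intro τ hτ
    have h1 := hpar (s * τ) (by rw [abs_mul, hsabs, one_mul]; exact hτ)
    simp only [he', hgs, hφs, smul_smul]
    rw [show z + (τ * s) • e + g (s * τ) = z + (s * τ) • e + g (s * τ) by rw [mul_comm], h1]
    congr 1; rw [mul_assoc, mul_comm (φ (s * τ)) s, ← mul_assoc, hs1, one_mul]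
  have hσs_eq : ∀ t, σs t = ⟪e', Y t - z⟫ := by
    intro t; simp only [hσs, he', real_inner_smul_left, hσ]
  have hξs_eq : ∀ t, ξ t = Y t - z - σs t • e' - gs (σs t) := by
    intro t
    simp only [hσs, he', hgs, smul_smul]
    rw [show s * σ t * s = σ t by rw [mul_comm, ← mul_assoc, hs1, one_mul],
      show s * (s * σ t) = σ t by rw [← mul_assoc, hs1, one_mul]]
  have hφs_sq : ∀ t, φs (σs t) ^ 2 = φ (σ t) ^ 2 := by
    intro t
    simp only [hφs, hσs]
    rw [show s * (s * σ t) = σ t by rw [← mul_assoc, hs1, one_mul], mul_pow, show s ^ 2 = 1 by rw [sq, hs1],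
      one_mul]
  have hφs_abs : ∀ t, |φs (σs t)| = |φ (σ t)| := by
    intro t
    simp only [hφs, hσs]
    rw [show s * (s * σ t) = σ t by rw [← mul_assoc, hs1, one_mul], abs_mul, hsabs, one_mul]
  have hEs : ∀ t ∈ Icc 0 t₁, ‖V (Y t) - φs (σs t) • e' - A (ξ t)‖ ≤ ρ * ‖ξ t‖ := by
    intro t ht
    have e1 : φs (σs t) • e' = φ (σ t) • e := by
      simp only [hφs, hσs, he', smul_smul]
      rw [show s * (s * σ t) = σ t by rw [← mul_assoc, hs1, one_mul],
        show s * φ (σ t) * s = φ (σ t) by rw [mul_comm, ← mul_assoc, hs1, one_mul]]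
    rw [e1]; exact hE t ht
  have hσs' : ∀ t, HasDerivAt σs (-φs (σs t) - ⟪e', V (Y t) - φs (σs t) • e' - A (ξ t)⟫) t := by
    intro t
    have h1 := (hσ' t).const_mul s
    refine h1.congr_deriv ?_
    have e1 : φs (σs t) • e' = φ (σ t) • e := by
      simp only [hφs, hσs, he', smul_smul]
      rw [show s * (s * σ t) = σ t by rw [← mul_assoc, hs1, one_mul],
        show s * φ (σ t) * s = φ (σ t) by rw [mul_comm, ← mul_assoc, hs1, one_mul]]
    rw [e1]
    simp only [hφs, hσs, he', real_inner_smul_left]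
    rw [show s * (s * σ t) = σ t by rw [← mul_assoc, hs1, one_mul]]
    ring
  have hpds : ∀ t ∈ Icc 0 t₁, pd t ≤ -μ * p t + 18 * ρ ^ 2 / μ * (p t + m t) + 2 * (L * r) ^ 2 / μ * φs (σs t) ^ 2 :=
    fun t ht => by rw [hφs_sq t]; exact hpd t ht
  have hmds : ∀ t ∈ Icc 0 t₁,
      μ * m t - 18 * ρ ^ 2 / μ * (p t + m t) - 2 * (L * r) ^ 2 / μ * φs (σs t) ^ 2 ≤ md t :=
    fun t ht => by rw [hφs_sq t]; exact hmd t ht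
  have hM₁s : ∀ t ∈ Icc 0 t₁, |φs (σs t)| ≤ M₁ := fun t ht => by rw [hφs_abs t]; exact hM₁ t ht
  have hstag' : ∀ t ∈ Icc 0 t₁, selfSimilarTransport γ c U (Y t) ≠ 0 := hstag
  /- the side alternative -/
  rcases hside s hs1 with harc | ⟨σ₀, hσ₀, hφσ₀, hε1, hε2, hε3a, hε3b⟩
  · -- arc side
    have harcs : ∀ τ ∈ Icc (r / 4) (r / 2), φs τ = 0 := fun τ hτ => by
      simp only [hφs]; rw [harc τ hτ, mul_zero]
    exact false_of_exit_arcSide (γ := γ) (c := c) (U := U) he'1 hμ hμα hK hpars hr hrδ hε hεr hρ hY ht₁ hin hxε'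
      hstag' hσs_eq hξs_eq hpm hpnn hmnn hp' hm' hpds hmds hσs' hEs hM₁0 hκ hΘ hρ1 hsmall hsσ harcs hM₁r
      hrArc hεArc
  · -- bump side: the forcing point is crossed before the exit, so `M₁ ≥ |φ(sσ₀)|`
    have hσsc : Continuous σs := continuous_const.mul hσc
    have hσs0 : σs 0 ≤ σ₀ := by
      have h1 : |σs 0| ≤ ε := by
        rw [hσs_eq 0]; exact ((abs_real_inner_le_norm e' _).trans (by rw [he'1, one_mul])).trans hxε'.le
      linarith [(abs_le.1 h1).2, hσ₀.1]
    have hσs1 : σ₀ ≤ σs t₁ := hσ₀.2.trans hsσ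
    obtain ⟨tc, htc, hσtc⟩ : ∃ tc ∈ Icc 0 t₁, σs tc = σ₀ :=
      intermediate_value_Icc ht₁.le hσsc.continuousOn ⟨hσs0, hσs1⟩
    have hmplusM : |φ (s * σ₀)| ≤ M₁ := by
      have h1 := hM₁s tc htc
      rw [hσtc] at h1
      simp only [hφs, abs_mul, hsabs, one_mul] at h1
      exact h1
    have hmplus : 0 < |φ (s * σ₀)| := abs_pos.2 hφσ₀
    have hmaxs : |φs (σs tstar)| = M₁ := by rw [hφs_abs tstar]
    -- reflected graph data for the bump lemma
    have hgs0 : gs 0 = 0 := by simp [hgs, hg0]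
    have hges : ∀ τ, ⟪e', gs τ⟫ = 0 := by
      intro τ; simp only [he', hgs, real_inner_smul_left, hge, mul_zero]
    have hgsd : ∀ τ, HasDerivAt gs (s • g' (s * τ)) τ := by
      intro τ
      have h1 : HasDerivAt (fun τ => g (s * τ)) ((s * 1) • g' (s * τ)) τ :=
        (hgd (s * τ)).scomp τ ((hasDerivAt_id τ).const_mul s)
      rw [mul_one] at h1
      exact h1
    have hgs' : ∀ τ, |τ| ≤ δ → ‖s • g' (s * τ)‖ ≤ L * |τ| := by
      intro τ hτ
      rw [norm_smul, Real.norm_eq_abs, hsabs, one_mul]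
      have := hg' (s * τ) (by rw [abs_mul, hsabs, one_mul]; exact hτ)
      rwa [abs_mul, hsabs, one_mul] at this
    have hφsc : Continuous φs := continuous_const.mul (hφc.comp (continuous_const.mul continuous_id))
    have hφssq : ∀ τ, |τ| ≤ δ → |φs τ| ≤ C₁ * τ ^ 2 := by
      intro τ hτ
      simp only [hφs]; rw [abs_mul, hsabs, one_mul]
      have := hφsq (s * τ) (by rw [abs_mul, hsabs, one_mul]; exact hτ)
      rwa [mul_pow, show s ^ 2 = 1 by rw [sq, hs1], one_mul] at this
    have hφslip : ∀ τ τ', |τ| ≤ δ → |τ'| ≤ δ → |φs τ - φs τ'| ≤ C₁ * δ * |τ - τ'| := by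
      intro τ τ' hτ hτ'
      simp only [hφs]
      rw [← mul_sub, abs_mul, hsabs, one_mul]
      have := hφlip (s * τ) (s * τ') (by rw [abs_mul, hsabs, one_mul]; exact hτ)
        (by rw [abs_mul, hsabs, one_mul]; exact hτ')
      rwa [← mul_sub, abs_mul, hsabs, one_mul] at this
    have hηU' := hηU
    exact false_of_exit_bump h hγ2 hΩz he'1 hAe's hb hμ hμα hpos_i hneg_i' hK (by linarith [hrδ, hr]) hL hC₁pos
      hgs0 hges hgsd hgs' hpars hφsc hφssq hφslip hρ hη hν hCν hηU' hexp hr hrδ hε hεr hC₃ hY ht₁ hin hxε'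
      hHlt hH0 hσs_eq hξs_eq hpm hmnn hAξ hσs' hEs hM₁s hκ hΘ hρ2 hsmall htstar hmaxs hmplus hmplusM hrθ hLr
      hρ3 hε1 hε2 hrBump hε3a hε3b

end Summit.NavierStokesRegularity.NavierStokesRegularity.Theorems.PowerGaugeEulerLiouville.NodalContinuum
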